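import Mathlib
import HarnessLib
import Summits.ResolutionOfSingularities.ResolutionOfSingularities.Theorems.WildQuotientsWildQuotientResolutionS1aMoveStep

/-!
# S1a — (S4) IDLE CHARTS of the move: over an idle chart the blow-up is an isomorphism and the node chart lifts

[OURS · L1 W4.5c · lead-1 g6] — NOT a statement of the manuscript; counted 0; AI-level work, weaker than expert
review. Crux stmt-ResolutionOfSingularities-17941 (`WildQuotients.CyclicQuotientFourfolds`), line `s1a-logminvertex`,
stub `stub_localGame` (producer); A5b design `Cruxes/CyclicQuotientFourfolds/Lines/s1a-logminvertex-A5B-DESIGN.md`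
(S4), plan-1 RULING 22:26:15Z. Towards H4c `BlowupNodeAtlas p` (`…S1aMoveStep`, p574006): for a blow-up
`π : V' ⟶ V` of a `G`-stable ideal sheaf `I` with the LIFTED action `liftActionOver ρ hπ hρ`,

* `preimage_stable` — the preimage `π⁻¹ O` of a `G`-stable open is stable for the lifted action;
* `appLE_lift_comm` — on sections, the lifted automorphism over `π⁻¹ O` and the original one over `O` commute with
  `π.app O` (naturality);
* `disjoint_support_of_ideal_eq_top` — an affine open on which the ideal is the unit ideal misses the support, so
  `π ∣_ O` is an isomorphism (`IsBlowup.isIso_morphismRestrict`) and `π.app O` is a ring isomorphism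
  (`isIso_app_of_isIso_morphismRestrict`);
* **`exists_isNodeChart_preimage_of_isIdleChart`** — an IDLE chart `O` of an admissible centre (H4b `IsIdleChart`:
  a node chart on which `𝒦` is the unit filtration) lifts to a node chart `π⁻¹ O` of `V'` for the lifted action, with
  the same node `(B, 𝒜, σ)` (the iso `Γ(V', π⁻¹O) ≃ Γ(V, O) ≃ 𝒜 0` intertwines the actions of `g₀`).
-/

set_option linter.dupNamespace false

noncomputable section

open CategoryTheory AlgebraicGeometry TopologicalSpace
open Literature.AlgebraicGeometry.Resolution Literature.AlgebraicGeometry.RelativeSpec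
open Summit.ResolutionOfSingularities.ResolutionOfSingularities.Theorems.WildQuotientResolution.S1
open Summit.ResolutionOfSingularities.ResolutionOfSingularities.Theorems.WildQuotientResolution.S1.NodeAtlas
open Summit.ResolutionOfSingularities.ResolutionOfSingularities.Theorems.WildQuotientResolution.S1.MoveStep

namespace Summit.ResolutionOfSingularities.ResolutionOfSingularities.Theorems.WildQuotientResolution.S1.BlowupCharts

universe u

variable {V' V Y : Scheme.{u}} {π : V' ⟶ V} {q : V ⟶ Y} {I : V.IdealSheafData} {G : Type u} [Group G]
  (ρ : ActionOver q G) (hπ : IsBlowup π I) (hρ : ∀ g : G, I.comap (ρ.aut g).hom = I)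

/-! ## Stability and naturality over a stable open -/

/-- The preimage of a `G`-stable open is stable for the lifted action. -/
theorem preimage_stable (O : V.Opens) (hO : ∀ g : G, (ρ.aut g).hom ⁻¹ᵁ O = O) (g : G) :
    ((liftActionOver ρ hπ hρ).aut g).hom ⁻¹ᵁ (π ⁻¹ᵁ O) = π ⁻¹ᵁ O := by
  rw [← Scheme.Hom.comp_preimage, liftActionOver_aut_hom_comp ρ hπ hρ g, Scheme.Hom.comp_preimage, hO]

/-- **Naturality on sections**: the lifted automorphism on `Γ(V', π⁻¹ O)` and the original one on `Γ(V, O)` commute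
with `π.app O`. -/
theorem appLE_lift_comm (O : V.Opens) (hO : ∀ g : G, (ρ.aut g).hom ⁻¹ᵁ O = O) (g : G) (s : Γ(V, O)) :
    ((liftActionOver ρ hπ hρ).aut g).hom.appLE (π ⁻¹ᵁ O) (π ⁻¹ᵁ O) (preimage_stable ρ hπ hρ O hO g).ge
        (π.appLE O (π ⁻¹ᵁ O) le_rfl s) =
      π.appLE O (π ⁻¹ᵁ O) le_rfl ((ρ.aut g).hom.appLE O O (hO g).ge s) := by
  have key : ∀ (φ ψ : V' ⟶ V) (h : φ = ψ) (e₁ : π ⁻¹ᵁ O ≤ φ ⁻¹ᵁ O) (e₂ : π ⁻¹ᵁ O ≤ ψ ⁻¹ᵁ O),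
      φ.appLE O (π ⁻¹ᵁ O) e₁ = ψ.appLE O (π ⁻¹ᵁ O) e₂ := by
    intro φ ψ h e₁ e₂; subst h; rfl
  change (π.appLE O (π ⁻¹ᵁ O) le_rfl ≫ ((liftActionOver ρ hπ hρ).aut g).hom.appLE (π ⁻¹ᵁ O) (π ⁻¹ᵁ O) _) s =
    ((ρ.aut g).hom.appLE O O (hO g).ge ≫ π.appLE O (π ⁻¹ᵁ O) le_rfl) s
  rw [Scheme.Hom.appLE_comp_appLE, Scheme.Hom.appLE_comp_appLE]
  exact congrArg (fun φ : Γ(V, O) ⟶ Γ(V', π ⁻¹ᵁ O) => φ s)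
    (key _ _ (liftActionOver_aut_hom_comp ρ hπ hρ g) _ _)

/-! ## Where the ideal is the unit ideal, the blow-up is an isomorphism -/

omit [Group G] in
/-- An affine open on which the ideal is the unit ideal misses the support. -/
theorem disjoint_support_of_ideal_eq_top {O : V.Opens} (hO : IsAffineOpen O) (h : I.ideal ⟨O, hO⟩ = ⊤) :
    Disjoint (O : Set V) I.support := by
  rw [Set.disjoint_left]
  intro x hx hsupp
  have := (Scheme.IdealSheafData.mem_support_iff_of_mem (I := I) (U := ⟨O, hO⟩) hx).mp hsupp
  rw [h] at this
  exact (Scheme.mem_zeroLocus_iff _ _ _).mp this 1 trivial (by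
    rw [Scheme.basicOpen_one]; exact hx)

omit [Group G] in
/-- If `π ∣_ O` is an isomorphism then so is `π.app O : Γ(V, O) ⟶ Γ(V', π⁻¹ O)`. -/
theorem isIso_app_of_isIso_morphismRestrict (O : V.Opens) (h : IsIso (π ∣_ O)) :
    IsIso (π.appLE O (π ⁻¹ᵁ O) le_rfl) := by
  have hres : IsIso (π.resLE O (π ⁻¹ᵁ O) le_rfl) := by
    rw [Scheme.Hom.resLE_eq_morphismRestrict]; exact h
  have : IsIso (π.resLE O (π ⁻¹ᵁ O) le_rfl).appTop := by
    change IsIso ((π.resLE O (π ⁻¹ᵁ O) le_rfl).app ⊤)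
    infer_instance
  exact (Arrow.isIso_hom_iff_isIso_of_isIso (arrowResLEAppIso π O (π ⁻¹ᵁ O) le_rfl).hom).mp this

/-! ## Idle charts lift -/

variable {p : ℕ} (g₀ : G)

/-- **(S4) An idle chart lifts to a node chart of the blow-up** for the lifted action, with the same node.
[OURS · L1 W4.5c] -/
theorem exists_isNodeChart_preimage_of_isIdleChart (𝒦 : ReesFiltration V) (d : ℕ) (hI : I = 𝒦.ideal d)
    (O : ρ.StableAffineOpens) (hidle : IsIdleChart p ρ g₀ 𝒦 O) :
    ∃ O' : (liftActionOver ρ hπ hρ).StableAffineOpens, O'.1 = π ⁻¹ᵁ O.1 ∧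
      IsNodeChart p (liftActionOver ρ hπ hρ) g₀ O' := by
  obtain ⟨hnode, htop⟩ := hidle
  have hO : IsAffineOpen O.1 := hnode.1
  -- `π ∣_ O` is an isomorphism
  have hdisj : Disjoint (O.1 : Set V) I.support := by
    subst hI
    exact disjoint_support_of_ideal_eq_top hO (by rw [← ReesFiltration.filtration_ideal]; exact htop d)
  haveI hiso : IsIso (π ∣_ O.1) := hπ.isIso_morphismRestrict hdisj
  haveI hP : IsIso (π.appLE O.1 (π ⁻¹ᵁ O.1) le_rfl) := isIso_app_of_isIso_morphismRestrict O.1 hiso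
  -- the new index
  have hstab : ∀ g : G, ((liftActionOver ρ hπ hρ).aut g).hom ⁻¹ᵁ (π ⁻¹ᵁ O.1) = π ⁻¹ᵁ O.1 :=
    preimage_stable ρ hπ hρ O.1 O.2.1
  haveI : IsAffineHom ((π ⁻¹ᵁ O.1).ι ≫ π ≫ q) := by
    rw [← Category.assoc, ← morphismRestrict_ι, Category.assoc]
    haveI := O.2.2
    infer_instance
  let O' : (liftActionOver ρ hπ hρ).StableAffineOpens := ⟨π ⁻¹ᵁ O.1, hstab, inferInstance⟩
  have hO' : IsAffineOpen (π ⁻¹ᵁ O.1) := by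
    haveI : IsAffine (O.1 : Scheme.{u}) := hO
    exact IsAffine.of_isIso (π ∣_ O.1)
  refine ⟨O', rfl, hO', ?_⟩
  -- the node data, transported along `π.app O`
  obtain ⟨-, m, r, B, _, 𝒜, _, σ, e, htame, hσ⟩ := hnode
  obtain ⟨P, hPapply⟩ : ∃ P : Γ(V, O.1) ≃+* Γ(V', π ⁻¹ᵁ O.1),
      ∀ s, P s = π.appLE O.1 (π ⁻¹ᵁ O.1) le_rfl s :=
    ⟨(asIso (π.appLE O.1 (π ⁻¹ᵁ O.1) le_rfl)).commRingCatIsoToRingEquiv, fun _ => rfl⟩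
  refine ⟨m, r, B, inferInstance, 𝒜, inferInstance, σ, P.symm.trans e, htame, fun t => ?_⟩
  obtain ⟨s, rfl⟩ := P.surjective t
  have h1 : ((liftActionOver ρ hπ hρ).aut g₀⁻¹).hom.appLE (π ⁻¹ᵁ O.1) (π ⁻¹ᵁ O.1) (hstab g₀⁻¹).ge (P s) =
      P ((ρ.aut g₀⁻¹).hom.appLE O.1 O.1 (O.2.1 g₀⁻¹).ge s) := by
    rw [hPapply, hPapply]
    exact appLE_lift_comm ρ hπ hρ O.1 O.2.1 g₀⁻¹ s
  rw [RingEquiv.trans_apply, RingEquiv.trans_apply, h1, P.symm_apply_apply, P.symm_apply_apply]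
  exact hσ s

end Summit.ResolutionOfSingularities.ResolutionOfSingularities.Theorems.WildQuotientResolution.S1.BlowupCharts

end
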